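import Summits.CriticalPhenomena.PercolationContinuityZ3.Theorems.Transplant.SkelPhiQStepsN
import Summits.CriticalPhenomena.PercolationContinuityZ3.Theorems.Transplant.SkelPhiStepINegOrient
import Summits.CriticalPhenomena.PercolationContinuityZ3.Theorems.Transplant.SkelPhiRootBridgeGeom
import Summits.CriticalPhenomena.PercolationContinuityZ3.Theorems.Transplant.SkelPhiPsiStepsCriticalProb
import HarnessLib

/-!
# Quasi-step rung (N3-b) under the rung's step field (ι) := `Skelφ.QStepsN G φ M` (EXACT start footprint; design owner p3-g29 2026-08-27 06:01Z after the
# refuter's F1–F3): the LEVEL-0 transports and bridges — `QStepsN` passes to every derived map of the From machinery (transpose, orientation, translation,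
# coordinatewise signs, the signed root frame; rows β1/β2 of WAVE-Q-MANIFEST), implies `PsiSteps` (hence `p_c < 1` from frames, row γ1) and `WeakSteps` of the
# same map (the first edge of a link; row β4 / Q1), all with the SAME cost `M`

builds on p205010 (kernel theorem, internal audit signed; external expert review pending) — nothing in this file uses p205010; nothing here is a claim about any open node; no carrier,
no node, no definition.  Lane `prim-bschramm`, seat `prim-bschramm-gen-1` (gen 4; GEN pen).  Helper file (`--supports stmt-CriticalPhenomena-4575 --as helper`).
WHY (HOME/WAVE-Q-MANIFEST.md v0.3 §3 rows β1/β2/β4/γ1; refuter p5-g28 F2: under the exact footprint 'every derived map `g ∘ φ` inherits `F u = F w`').  `Skelφ.QStepsN G F N`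
(«SkelPhiQStepsN» :46): every unit move of `F` is realised by a `LinkN` — a walk of length `≤ N` whose every vertex has `F`-value `F w` or IS the far end.  For a map
`g : ℤ² → ℤ²` under which unit moves go to unit moves (`g (x + σ′ e_{i′}) = g x + σ eᵢ` for a suitable source direction), `QStepsN G (g ∘ F) N` follows at once
(`QStepsN.comp`): the five derived maps of the cone are such `g`'s.  A link realising a unit move has positive length, and its FIRST EDGE ends at a vertex with the
start value or at the far end: `QStepsN.exists_adj_eq_or` — whence `WeakSteps` (ADJACENT non-retreating neighbour) for `F` itself (`weakSteps_of_qStepsN`; the cell maps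
of «SkelPhiCellsWeakG» follow in their own file).  Regression: `qStepsN_of_steps` (M = 1, «SkelPhiQStepsN»).
* §1 `LinkN.comp`, **`QStepsN.comp`**, `QStepsN.trφ/oriφ/sub_const/units_smul/rootFrame`;
* §2 **`psiSteps_of_qStepsN`**, **`criticalProb_lt_one_of_frames_qStepsN`** (γ1 through the bridge);
* §3 **`QStepsN.exists_adj_eq_or`**, **`weakSteps_of_qStepsN`**.
[cite: KozmaNitzan2024, §4 Lemma 10 Step III (p. 19), p. 26 ((29))] [cite: MartineauTassion2017, §3.2, §4.3] [cite: BenjaminiSchramm1996, §2 Conj. 1]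
-/

noncomputable section

open scoped Classical

namespace Summit.CriticalPhenomena.PercolationContinuityZ3.Theorems.Transplant

namespace Skelφ

open SimpleGraph Literature.Probability.LatticeModels Literature.Probability.Percolation

variable {V : Type} {G : SimpleGraph V} {F : V → Site 2} {N : ℕ}

/-! ## §1 Transport along maps of the plane taking unit moves to unit moves -/

/-- A link for `F` is a link for `g ∘ F` (the exact footprint is preserved by any map). [folklore] -/
theorem LinkN.comp {w w' : V} (h : LinkN G F N w w') (g : Site 2 → Site 2) : LinkN G (fun v => g (F v)) N w w' := by
  obtain ⟨p, hp, hF⟩ := h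
  refine ⟨p, hp, fun u hu => ?_⟩
  rcases hF u hu with h1 | h1
  · exact Or.inl (by show g (F u) = g (F w); rw [h1])
  · exact Or.inr h1

/-- **Transport of `QStepsN`**: if every unit move `(i, σ)` of the image is the image of some unit move `(i′, σ′)` under `g` (uniformly in the base point),
then `QStepsN G F N ⇒ QStepsN G (g ∘ F) N`. [folklore] -/
theorem QStepsN.comp (h : QStepsN G F N) (g : Site 2 → Site 2)
    (hg : ∀ (i : Fin 2) (σ : ℤˣ), ∃ (i' : Fin 2) (σ' : ℤˣ), ∀ x : Site 2, g (x + Pi.single i' (σ' : ℤ)) = g x + Pi.single i (σ : ℤ)) :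
    QStepsN G (fun v => g (F v)) N := by
  intro w i σ
  obtain ⟨i', σ', hg'⟩ := hg i σ
  obtain ⟨w', hw', hl⟩ := h w i' σ'
  exact ⟨w', by show g (F w') = g (F w) + _; rw [hw', hg'], hl.comp g⟩

/-- **`QStepsN` is transposition-invariant** (twin of `steps_trφ`). [cite: KozmaNitzan2024, §4 p. 16 (Lemma 8)] -/
theorem QStepsN.trφ (h : QStepsN G F N) : QStepsN G (Skelφ.trφ F) N := by
  refine h.comp (fun x j => x j.rev) fun i σ => ⟨i.rev, σ, fun x => funext fun j => ?_⟩
  simp only [Pi.add_apply, Pi.single_apply]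
  by_cases hj : j = i
  · subst hj; simp
  · have : j.rev ≠ i.rev := fun e => hj (Fin.rev_injective e)
    simp [hj, this]

/-- **`QStepsN` of the oriented map** (twin of `steps_oriφ`). [cite: KozmaNitzan2024, §4 p. 16 (Lemma 8)] -/
theorem QStepsN.oriφ (h : QStepsN G F N) (b : Bool) : QStepsN G (Skelφ.oriφ F b) N := by
  cases b
  · exact h.trφ
  · exact h

/-- **`QStepsN` is translation-invariant** (twin of `steps_sub_const`). [folklore] -/
theorem QStepsN.sub_const (h : QStepsN G F N) (c : Site 2) : QStepsN G (fun v => F v - c) N :=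
  h.comp (fun x => x - c) fun i σ => ⟨i, σ, fun x => by abel⟩

/-- **`QStepsN` under coordinatewise signs** `s i = ±1` — the chart of the reflected carrier `Φ.reflect s` (twin of its step field). [folklore] -/
theorem QStepsN.units_smul (h : QStepsN G F N) (s : Fin 2 → ℤˣ) : QStepsN G (fun w j => (s j : ℤ) * F w j) N := by
  refine h.comp (fun x j => (s j : ℤ) * x j) fun i σ => ⟨i, s i * σ, fun x => funext fun j => ?_⟩
  simp only [Pi.add_apply, mul_add]
  by_cases hj : j = i
  · subst hj
    rw [Pi.single_eq_same, Pi.single_eq_same, Units.val_mul, ← mul_assoc, ← Units.val_mul, Int.units_mul_self, Units.val_one, one_mul]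
  · rw [Pi.single_eq_of_ne hj, Pi.single_eq_of_ne hj, mul_zero]

/-- **`QStepsN` of the signed root frame** `w ↦ (σ·(F w 0 − F t 0), F w 1 − F t 1)`, `σ = ±1` (twin of `steps_rootFrame`). [cite: MartineauTassion2017, §3.2] -/
theorem QStepsN.rootFrame (h : QStepsN G F N) (t : V) {σ : ℤ} (hσ : σ = 1 ∨ σ = -1) : QStepsN G (Skelφ.rootFrame F t σ) N := by
  obtain ⟨sσ, hsσ⟩ : ∃ sσ : ℤˣ, (sσ : ℤ) = σ := by
    rcases hσ with rfl | rfl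
    exacts [⟨1, rfl⟩, ⟨-1, rfl⟩]
  have key := (h.sub_const (F t)).units_smul (fun j => if j = 0 then sσ else 1)
  have e : (fun w j => ((fun j => if j = 0 then sσ else (1 : ℤˣ)) j : ℤ) * (F w - F t) j) = Skelφ.rootFrame F t σ := by
    funext w j
    fin_cases j
    · simp [Skelφ.rootFrame, hsσ]
    · simp [Skelφ.rootFrame]
  rw [e] at key
  exact key

/-! ## §2 Exact footprint ⇒ hull footprint: `PsiSteps`, and `p_c < 1` from frames -/

/-- **`QStepsN ⇒ PsiSteps`** with the same cost: a vertex at the start value or equal to the far end lies in the widened hull of the two end values. [folklore] -/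
theorem psiSteps_of_qStepsN (h : QStepsN G F N) : PsiSteps G F N := by
  intro w i σ
  obtain ⟨w', hw', p, hp, hF⟩ := h w i σ
  refine ⟨w', hw', p, hp, fun u hu => ?_⟩
  rcases hF u hu with h1 | h1
  · rw [h1]; exact inHull_left _ _
  · rw [h1]; exact inHull_right _ _

/-- **`p_c < 1` from frames and exact-footprint quasi-steps** (row γ1 through the bridge): a connected locally finite graph with a planar map carrying translating frames
with finitely many types and `QStepsN` of any cost has `criticalProb G v < 1` at every vertex. [cite: BenjaminiSchramm1996, §2 Conj. 1; Thm. 1] [cite: LyonsPeres2016, §7.4 Thm. 7.15] -/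
theorem criticalProb_lt_one_of_frames_qStepsN [G.LocallyFinite] {types : Finset V} (hc : G.Connected) (hfr : Frames G F types) (h : QStepsN G F N)
    (v : V) : criticalProb G v < 1 :=
  criticalProb_lt_one_of_frames_psiSteps hc hfr (psiSteps_of_qStepsN h) v

/-! ## §3 The first edge of a link: weak steps -/

/-- **The first edge of a link**: under `QStepsN`, every vertex has, for every direction, an ADJACENT vertex whose `F`-value is the start value or the moved value.
[folklore] -/
theorem QStepsN.exists_adj_eq_or (h : QStepsN G F N) (y : V) (i : Fin 2) (σ : ℤˣ) :
    ∃ m : V, G.Adj y m ∧ (F m = F y ∨ F m = F y + Pi.single i (σ : ℤ)) := by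
  obtain ⟨w', hw', p, -, hF⟩ := h y i σ
  -- the link has positive length: its far end has a different `F`-value
  have hne : y ≠ w' := by
    intro e
    have := congrFun hw' i
    rw [← e, Pi.add_apply, Pi.single_eq_same] at this
    rcases Int.units_eq_one_or σ with h1 | h1 <;> simp [h1] at this
  cases p with
  | nil => exact absurd rfl hne
  | cons hadj p' =>
    rename_i m
    refine ⟨m, hadj, ?_⟩
    rcases hF m (by rw [Walk.support_cons]; exact List.mem_cons_of_mem _ (Walk.start_mem_support _)) with h1 | h1
    · exact Or.inl h1
    · exact Or.inr (by rw [h1, hw'])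

/-- **`QStepsN ⇒ WeakSteps` of the same map** (row β4 / item Q1 under the exact footprint): the first edge of the link realising `+σ eᵢ` does not move coordinate `i`
against `σ`. [folklore] -/
theorem weakSteps_of_qStepsN (h : QStepsN G F N) : WeakSteps G F := by
  intro y i σ
  obtain ⟨m, hadj, hm⟩ := h.exists_adj_eq_or y i σ
  refine ⟨m, hadj, ?_⟩
  rcases hm with h1 | h1
  · rw [h1, sub_self, mul_zero]
  · rw [h1, Pi.add_apply, Pi.single_eq_same, add_sub_cancel_left, ← sq]
    exact sq_nonneg _

end Skelφ

end Summit.CriticalPhenomena.PercolationContinuityZ3.Theorems.Transplant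

end
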